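import Literature.MathematicalPhysics.QuantumFieldTheory.LatticeMaxwellBlockSteinRegularity
import Literature.Barriers.CriticalPhenomena.RigorousRGSmallParameterGaussianIBP
import HarnessLib

/-!
# The lattice-Maxwell block law is the field-space Gaussian `P_C`; Gaussian integration by parts
# (Meckes 2009, Lemma 1 (1)) for the block law

Continuation of `LatticeMaxwellBlockOU.lean`. The block marginal `γ_B = latticeMaxwellBlockLaw B D`
of the curvature Gaussian field (`d ≥ 3`) is a centred Gaussian measure on `↥B → Fin D → ℝ` with
covariance `Cov(Y_p^a, Y_q^b) = [a = b]·(dGd*)(p,q)`. This file proves: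

* `latticeMaxwellBlockLaw_eq_fieldGaussian` — `γ_B` IS the Gaussian measure `P_C` of the tree's
  `RigorousRGSmallParameterGaussianIntegration` (`fieldGaussian`, Mathlib's `multivariateGaussian
  0 (C ⊗ 1_D)` transported to field space) with `C = curvatureTwoPoint|_B` — two centred Gaussians
  with the same covariance (Mathlib `IsGaussian.ext`); `posSemidef_blockTwoPoint`;
* `integral_eval_mul_latticeMaxwellBlockLaw` — **Gaussian integration by parts**
  `E[Y_p^a F(Y)] = Σ_q (dGd*)(p,q) E[∂_{(q,a)}F(Y)]` for `C¹` functions `F` with `F, DF` bounded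
  (the tree's `fieldGaussian_ibp`, degenerate covariances included);
* `integral_fderiv_apply_self_latticeMaxwellBlockLaw` — its trace form, Meckes' Lemma 1 (1)
  "`E⟨Hess f(Z), Σ⟩_HS = E⟨Z, ∇f(Z)⟩`": `E[DF(Y)[Y]] = Σ_{s,t} Γ_B(s,t) E[∂_t ∂_s F(Y)]`;
* coordinate bookkeeping on the block space (`sum_smul_latticeMaxwellBlockBasis`,
  `fderiv_apply_self_eq_sum`, `norm_latticeMaxwellBlockBasis_le`, `abs_eval_le_norm`).

Stein's equation (Lemma 1 (3)) is deduced in `LatticeMaxwellBlockSteinEquation.lean`.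

References: E. Meckes, IMS Collections 5 (2009) 153–178, arXiv:0902.0333, Lemma 1 (1) [Meckes2009];
D. Brydges, G. Slade, J. Stat. Phys. 159 (2015) 421, §2 (Gaussian integration by parts)
[BrydgesSlade2015RGI]; C. Garban, A. Sepúlveda, arXiv:2107.04021, §4 Proposition (law of the
gradient spin-wave) [GarbanSepulveda2023].
-/

noncomputable section

open MeasureTheory ProbabilityTheory Filter Set WithLp
open scoped Topology
open Literature.MathematicalPhysics.QuantumLattice (ZdPlaquette)
open Literature.Barriers.CriticalPhenomena.LongRangePhi4 (fieldGaussian componentMatrix fieldEquiv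
  componentMatrix_apply fieldEquiv_symm_apply)
open Literature.Barriers.CriticalPhenomena.LongRangePhi4.GaussIBP (fieldGaussian_ibp fdir)

namespace Literature.MathematicalPhysics.QuantumFieldTheory


section Block

open Literature.MathematicalPhysics.QuantumLattice

variable {d : ℕ} (B : Finset (ZdPlaquette d)) (D : ℕ)

/-! ### Coordinates of the block space -/

/-- Every block configuration is the sum of its coordinates times the coordinate vectors:
`y = Σ_{(p,a)} y_p^a e_{(p,a)}` (coordinates for "`⟨x, ∇h(x)⟩`"). [cite: Meckes2009, Lemma 1 (1)] -/
theorem sum_smul_latticeMaxwellBlockBasis (y : ↥B → Fin D → ℝ) :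
    ∑ s : ↥B × Fin D, y s.1 s.2 • latticeMaxwellBlockBasis B D s = y := by
  classical
  funext q b
  simp only [Finset.sum_apply, Pi.smul_apply, latticeMaxwellBlockBasis, smul_eq_mul, mul_ite,
    mul_one, mul_zero]
  rw [Finset.sum_eq_single (q, b)]
  · simp
  · rintro ⟨p, a⟩ - hne
    rw [if_neg]
    rintro ⟨rfl, rfl⟩
    exact hne rfl
  · intro h; exact absurd (Finset.mem_univ _) h

/-- `DF(y)[y] = Σ_{(p,a)} y_p^a ∂_{(p,a)}F(y)` ("`⟨x, ∇h(x)⟩ = Σᵢ xᵢ ∂h/∂xᵢ(x)`").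
[cite: Meckes2009, Lemma 1 (1)] -/
theorem fderiv_apply_self_eq_sum (F : (↥B → Fin D → ℝ) → ℝ) (y : ↥B → Fin D → ℝ) :
    fderiv ℝ F y y =
      ∑ s : ↥B × Fin D, y s.1 s.2 * fderiv ℝ F y (latticeMaxwellBlockBasis B D s) := by
  have h := congrArg (fun v => fderiv ℝ F y v) (sum_smul_latticeMaxwellBlockBasis B D y).symm
  simp only [map_sum, map_smul, smul_eq_mul] at h
  exact h

/-- The coordinate vectors have sup norm at most `1`. [cite: Meckes2009, Lemma 1 (1)] -/
theorem norm_latticeMaxwellBlockBasis_le (s : ↥B × Fin D) :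
    ‖latticeMaxwellBlockBasis B D s‖ ≤ 1 := by
  classical
  refine (pi_norm_le_iff_of_nonneg zero_le_one).2 fun q =>
    (pi_norm_le_iff_of_nonneg zero_le_one).2 fun b => ?_
  simp only [latticeMaxwellBlockBasis]
  split_ifs <;> simp

/-- `|y_p^a| ≤ ‖y‖` (sup norm of the block space). [cite: Meckes2009, Lemma 1 (1)] -/
theorem abs_eval_le_norm (y : ↥B → Fin D → ℝ) (s : ↥B × Fin D) : |y s.1 s.2| ≤ ‖y‖ :=
  (Real.norm_eq_abs _ ▸ norm_le_pi_norm (y s.1) s.2).trans (norm_le_pi_norm y s.1)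

/-! ### The block law is the field-space Gaussian `P_C`, `C = curvatureTwoPoint|_B` -/

/-- The block two-point matrix `((dGd*)(p,q))_{p,q ∈ B}` is positive semidefinite (`d ≥ 3`): it is
a principal submatrix of a Gram matrix of the positive semidefinite curvature kernel.
[cite: GarbanSepulveda2023, §4 Proposition (law of the gradient spin-wave)] -/
theorem posSemidef_blockTwoPoint (hd : 3 ≤ d) :
    (Matrix.of fun p q : ↥B => curvatureTwoPoint (p : ZdPlaquette d) (q : ZdPlaquette d)).PosSemidef := by
  classical
  set I : Finset (ZdPlaquette d × Fin 1) := B ×ˢ Finset.univ with hI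
  let f : ↥B → ↥I := fun p => ⟨((p : ZdPlaquette d), (0 : Fin 1)), by simp [hI]⟩
  have h := (isPosSemidefKernel_curvatureCovKernel hd 1 I).submatrix f
  have e : (Matrix.of fun p q : ↥B => curvatureTwoPoint (p : ZdPlaquette d) (q : ZdPlaquette d)) =
      (covGram (curvatureCovKernel d 1) I).submatrix f f := by
    ext p q
    simp [covGram_apply, f, curvatureCovKernel_apply]
  rw [e]; exact h

/-- **The block marginal of the curvature Gaussian field is the field-space Gaussian `P_C` with
`C = (dGd*)|_B`** (`d ≥ 3`): both are centred Gaussian measures on `↥B → Fin D → ℝ` with covariance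
`Cov(Y_p^a, Y_q^b) = [a = b]·(dGd*)(p,q)`, hence equal (a Gaussian law is determined by its mean
and covariance). [cite: GarbanSepulveda2023, §4 Proposition (law of the gradient spin-wave)] -/
theorem latticeMaxwellBlockLaw_eq_fieldGaussian (hd : 3 ≤ d) :
    latticeMaxwellBlockLaw B D =
      fieldGaussian ↥B
        (Matrix.of fun p q : ↥B => curvatureTwoPoint (p : ZdPlaquette d) (q : ZdPlaquette d)) D := by
  classical
  set C : Matrix ↥B ↥B ℝ :=
    Matrix.of fun p q : ↥B => curvatureTwoPoint (p : ZdPlaquette d) (q : ZdPlaquette d) with hC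
  have hCpsd : C.PosSemidef := posSemidef_blockTwoPoint B hd
  haveI := isProbabilityMeasure_latticeMaxwellBlockLaw B D hd
  haveI := isGaussian_latticeMaxwellBlockLaw B D hd
  set μ := latticeMaxwellBlockLaw B D with hμ
  apply (fieldEquiv ↥B D).symm.map_measurableEquiv_injective
  have hR : (fieldGaussian ↥B C D).map (fieldEquiv ↥B D).symm =
      multivariateGaussian 0 (componentMatrix C D) := by
    rw [fieldGaussian, Measure.map_map (fieldEquiv ↥B D).symm.measurable (fieldEquiv ↥B D).measurable,
      MeasurableEquiv.symm_comp_self, Measure.map_id]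
  change μ.map (fieldEquiv ↥B D).symm = (fieldGaussian ↥B C D).map (fieldEquiv ↥B D).symm
  rw [hR]
  -- the left-hand side as the law of the coordinate vector
  set X : ↥B × Fin D → (↥B → Fin D → ℝ) → ℝ := fun s ω => ω s.1 s.2 with hX
  have hLe : (⇑(fieldEquiv ↥B D).symm : (↥B → Fin D → ℝ) → EuclideanSpace ℝ (↥B × Fin D)) =
      fun ω => toLp 2 (X · ω) := by
    funext ω; rfl
  rw [hLe]
  -- a continuous linear version of the same map, for the Gaussian instance
  let T : (↥B → Fin D → ℝ) →L[ℝ] EuclideanSpace ℝ (↥B × Fin D) :=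
    ((PiLp.continuousLinearEquiv 2 ℝ (fun _ : ↥B × Fin D => ℝ)).symm :
        (↥B × Fin D → ℝ) →L[ℝ] EuclideanSpace ℝ (↥B × Fin D)).comp
      (LinearMap.toContinuousLinearMap
        { toFun := fun ω s => ω s.1 s.2
          map_add' := fun _ _ => rfl
          map_smul' := fun _ _ => rfl })
  have hT : (fun ω : ↥B → Fin D → ℝ => toLp 2 (X · ω)) = ⇑T := by
    funext ω; rfl
  haveI hGμ : IsGaussian (μ.map fun ω => toLp 2 (X · ω)) := by rw [hT]; infer_instance
  have hmem : ∀ s : ↥B × Fin D, MemLp (X s) 2 μ := fun s => by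
    have h := IsGaussian.memLp_dual μ
      ((ContinuousLinearMap.proj (R := ℝ) (φ := fun _ : Fin D => ℝ) s.2).comp
        (ContinuousLinearMap.proj (R := ℝ) (φ := fun _ : ↥B => Fin D → ℝ) s.1)) 2
      (by simp)
    exact h
  apply IsGaussian.ext
  · -- means vanish
    rw [integral_id_multivariateGaussian']
    have h1 : ∫ x, id x ∂(μ.map fun ω => toLp 2 (X · ω)) = ∫ ω, T ω ∂μ := by
      rw [hT, integral_map T.continuous.measurable.aemeasurable aestronglyMeasurable_id]; rfl
    have h2 := T.integral_comp_comm (μ := μ) (φ := fun ω => ω) IsGaussian.integrable_id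
    rw [h1, h2]
    have h0 : ∫ ω, ω ∂μ = 0 := by
      have hcoord : ∀ (p : ↥B) (a : Fin D), (∫ ω, ω ∂μ) p a = 0 := by
        intro p a
        have h := ((ContinuousLinearMap.proj (R := ℝ) (φ := fun _ : Fin D => ℝ) a).comp
          (ContinuousLinearMap.proj (R := ℝ) (φ := fun _ : ↥B => Fin D → ℝ) p)).integral_comp_comm
          (μ := μ) (φ := fun ω => ω) IsGaussian.integrable_id
        simp only [ContinuousLinearMap.coe_comp, Function.comp_apply,
          ContinuousLinearMap.proj_apply] at h
        rw [← h]
        exact integral_eval_latticeMaxwellBlockLaw B D hd p a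
      funext p a; exact hcoord p a
    rw [h0, map_zero]
  · -- covariances agree
    ext x y
    rw [covarianceBilin_apply_pi hmem, covarianceBilin_multivariateGaussian
      (Literature.Barriers.CriticalPhenomena.LongRangePhi4.posSemidef_componentMatrix hCpsd)]
    simp only [hX, dotProduct, Matrix.mulVec, Finset.mul_sum]
    refine Finset.sum_congr rfl fun s _ => Finset.sum_congr rfl fun t _ => ?_
    rw [covariance_eval_latticeMaxwellBlockLaw B D hd, componentMatrix_apply, hC, Matrix.of_apply]
    by_cases h : s.2 = t.2 <;> simp [h] ; ring

/-! ### Gaussian integration by parts for the block law -/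

/-- **Gaussian integration by parts for `γ_B`**: `E[Y_p^a F(Y)] = Σ_{q ∈ B} (dGd*)(p,q)
E[∂_{(q,a)}F(Y)]` for `C¹` functions `F` with `F`, `DF` bounded (`d ≥ 3`; degenerate block
covariances included). [cite: Meckes2009, Lemma 1 (1)] -/
theorem integral_eval_mul_latticeMaxwellBlockLaw (hd : 3 ≤ d) {F : (↥B → Fin D → ℝ) → ℝ}
    (hF : ContDiff ℝ 1 F) {K : ℝ} (hFb : ∀ y, |F y| ≤ K) (hF'b : ∀ y, ‖fderiv ℝ F y‖ ≤ K)
    (p : ↥B) (a : Fin D) :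
    ∫ y, y p a * F y ∂latticeMaxwellBlockLaw B D =
      ∑ q : ↥B, curvatureTwoPoint (p : ZdPlaquette d) (q : ZdPlaquette d) *
        ∫ y, fderiv ℝ F y (latticeMaxwellBlockBasis B D (q, a)) ∂latticeMaxwellBlockLaw B D := by
  classical
  rw [latticeMaxwellBlockLaw_eq_fieldGaussian B D hd]
  have h := fieldGaussian_ibp (n := D) (posSemidef_blockTwoPoint B hd) hF (B := K) (p := 0)
    (fun φ => by simpa using hFb φ) (fun φ => by simpa using hF'b φ) p a
  rw [h]
  refine Finset.sum_congr rfl fun q _ => ?_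
  rw [Matrix.of_apply]
  congr 2

/-- **Trace form of Gaussian integration by parts** (Meckes' Lemma 1 (1), "`E⟨Hess f(Z), Σ⟩_HS =
E⟨Z, ∇f(Z)⟩`", at the block law): `E[DF(Y)[Y]] = Σ_{s,t} Γ_B(s,t) E[∂_t ∂_s F(Y)]` for `F ∈ C²` with
bounded derivative and bounded derivatives of the partial derivatives `∂_s F` (`d ≥ 3`).
[cite: Meckes2009, Lemma 1 (1)] -/
theorem integral_fderiv_apply_self_latticeMaxwellBlockLaw (hd : 3 ≤ d)
    {F : (↥B → Fin D → ℝ) → ℝ} (hF : ContDiff ℝ 2 F) {K₁ K₂ : ℝ} (hK₁ : ∀ y, ‖fderiv ℝ F y‖ ≤ K₁)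
    (hK₂ : ∀ s y, ‖fderiv ℝ (fun y' => fderiv ℝ F y' (latticeMaxwellBlockBasis B D s)) y‖ ≤ K₂) :
    ∫ y, fderiv ℝ F y y ∂latticeMaxwellBlockLaw B D =
      ∑ s : ↥B × Fin D, ∑ t : ↥B × Fin D, latticeMaxwellBlockCov B D s t *
        ∫ y, fderiv ℝ (fun y' => fderiv ℝ F y' (latticeMaxwellBlockBasis B D s)) y
          (latticeMaxwellBlockBasis B D t) ∂latticeMaxwellBlockLaw B D := by
  classical
  haveI := isProbabilityMeasure_latticeMaxwellBlockLaw B D hd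
  set μ := latticeMaxwellBlockLaw B D with hμ
  set e := latticeMaxwellBlockBasis B D with he
  have hK₁0 : 0 ≤ K₁ := (norm_nonneg _).trans (hK₁ 0)
  -- the directional derivatives `F_s = ∂_s F` and their bounds
  have hFs : ∀ s, ContDiff ℝ 1 (fun y => fderiv ℝ F y (e s)) := fun s =>
    SteinOU.contDiff_one_fderiv_apply hF (e s)
  have hFsb : ∀ s y, |fderiv ℝ F y (e s)| ≤ K₁ := fun s y =>
    (SteinOU.abs_fderiv_apply_le hK₁ y (e s)).trans
      (by nlinarith [norm_latticeMaxwellBlockBasis_le B D s, norm_nonneg (e s)])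
  -- expand `DF(y)[y]` in coordinates and integrate term by term
  have hint : ∀ s : ↥B × Fin D, Integrable (fun y => y s.1 s.2 * fderiv ℝ F y (e s)) μ := by
    intro s
    refine Integrable.mono' ((integrable_norm_latticeMaxwellBlockLaw B D hd).const_mul K₁)
      ((Continuous.mul (by fun_prop) ((hFs s).continuous)).aestronglyMeasurable)
      (Eventually.of_forall fun y => ?_)
    rw [Real.norm_eq_abs, abs_mul]
    calc |y s.1 s.2| * |fderiv ℝ F y (e s)| ≤ ‖y‖ * K₁ :=
          mul_le_mul (abs_eval_le_norm B D y s) (hFsb s y) (abs_nonneg _) (norm_nonneg _)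
      _ = K₁ * ‖y‖ := mul_comm _ _
  simp_rw [fderiv_apply_self_eq_sum B D F]
  rw [integral_finsetSum _ fun s _ => hint s]
  refine Finset.sum_congr rfl fun s _ => ?_
  obtain ⟨p, a⟩ := s
  rw [integral_eval_mul_latticeMaxwellBlockLaw B D hd (hFs (p, a)) (K := max K₁ K₂)
    (fun y => (hFsb _ y).trans (le_max_left _ _)) (fun y => (hK₂ _ y).trans (le_max_right _ _)) p a]
  rw [Fintype.sum_prod_type]
  refine Finset.sum_congr rfl fun q _ => ?_
  rw [Finset.sum_eq_single a]
  · rw [latticeMaxwellBlockCov_apply, if_pos rfl]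
  · intro b _ hb
    rw [latticeMaxwellBlockCov_apply, if_neg (Ne.symm hb), zero_mul]
  · intro h; exact absurd (Finset.mem_univ _) h

end Block

end Literature.MathematicalPhysics.QuantumFieldTheory

end
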